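import Literature.NumberTheory.PAdicHodge.TateTwistPeriodLine
import Literature.NumberTheory.EllipticCurves.LocalTatePairingCupProductPadic
import Literature.NumberTheory.PAdicHodge.BdRCyclotomic
import HarnessLib

/-!
# The Weil pairing extended to `B ⊗ V_pW` along the period line, and Kato's formal argument (right factor):
# `η ∪ κ` is presented in `B` by `σ ↦ −⟨η σ, σ ỹ⟩~` whenever `κ = ∂ỹ` in `B ⊗ V_pW`

Topic `Literature/NumberTheory/PAdicHodge`. Sequel of `TateTwistPeriodLine` (`ι : ℤ_p(1)(F̄) → B_dR⁺(F)`, `ε^a ↦ a · t`),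
`EllipticCurves/LocalTatePairingCupProductPadic` (`e_∞ = weilContPairingPadic` on `T_pW|_{Γ_F}`, `⟨x, y⟩ = inv_∞(x ∪_{e_∞} y)`) and
`GaloisRepresentations/ContinuousCupProductCoboundaryLift` (`isCoboundaryLift_cupCocycle_right`). For a period-ring datum `𝔅` over
`(Γ_F, ℚ_p, F)` (tree `PeriodRingData`; the instance that matters is `bdRPeriodRingData hp`, `B = B_dR(F)`) receiving `B_dR⁺(F)` through
a ring map `j` (equivariant: `hj`; compatible with the `ℚ_p`-structures: `hjq`):

* §1 ★ `weilPairingPadicHom_smul_right` — **`e_∞(S, a • T) = e_∞(S, T)^a`**, `a ∈ ℤ_p` (the tree's `e_∞` is `ℤ_p`-bilinear in twist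
  form); `toAmbient : T_pW →+ 𝔅.B ⊗_{ℚ_p} V_pW`, `S ↦ 1 ⊗ (1 ⊗ S)`, equivariant for the diagonal `PeriodRingData.tensorRep`
  (`toAmbient_smul`, the hypothesis `hιY` of the formal argument).
* §2 `periodLineB 𝔅 j : ℤ_p(1)(F̄) →+ 𝔅.B`, `ζ ↦ j(ι ζ)`: twist-linearity, ★ equivariance `σ • ι_B ζ = ι_B(σ ζ)`, injectivity.
* §3 ★ `weilPeriodPairing : T_pW →+ (𝔅.B ⊗_{ℚ_p} V_pW) →+ 𝔅.B`, **`⟨S, b ⊗ (c ⊗ T)⟩~ = b · c · ι_B(e_∞(S, T))`** (two balanced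
  `TensorProduct.liftAddHom`s), ★ `weilPeriodPairing_toAmbient` (`⟨S, 1 ⊗ 1 ⊗ T⟩~ = ι_B(e_∞(S, T))`: `hcompat`),
  ★ `smul_weilPeriodPairing` (`σ • ⟨S, y⟩~ = ⟨σ S, σ y⟩~`: `hequiv`).
* §4 ★★ `isCoboundaryLift_weilContPairingPadic_right` — **Kato II Lemma 1.4.3, formal part, for `⟨η, κ⟩`**: if the `T_pW`-valued cocycle
  `κ` bounds in `𝔅.B ⊗ V_pW`, `1 ⊗ 1 ⊗ κ(τ) = τ ỹ − ỹ` (for a Kummer cocycle `κ = κ_P`: brick K1, `PeriodRingData.IsFilZeroCoboundary`,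
  `ỹ = y_P ∈ B_dR⁺ ⊗ V`), then for EVERY cocycle `η` the cochain **`g(σ) := −⟨η σ, σ ỹ⟩~ ∈ 𝔅.B` presents `η ∪_{e_∞} κ` through
  `ι_B`**; `…_of_isFilZeroCoboundary` (K1 form); ★★ `tatePairing_eq_invPadic_twoCocycleClass_of_isCoboundaryLift` — the tree's
  `ℤ_p`-valued local Tate pairing is **`⟨[η], [κ]⟩ = inv_∞[c]` for ANY continuous `2`-cocycle `c` of `ℤ_p(1)` presented by `g`**
  (`ι_B` injective): the left-hand side of Kato's reciprocity law as the invariant of the connecting class of an explicit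
  `B_dR`-valued cochain (what remains for [REC] is to RECOGNISE `g` — Kato's `X`).
* §5 the instance `𝔅 = bdRPeriodRingData hp`, `j = bdRPlusToFrac hp : B_dR⁺ ⊆ B_dR`: `periodLineFrac`; `hj` / `hjq` / injectivity discharged
  (`smul_algebraMap_fracBdR`, `embBdRHom_algebraMap_padic` under the canonical `ℚ_p`-structure `halg`, `algebraMap_fracBdR_injective`).

Definitions (reviewed): `toAmbient`, `periodLineB`, `weilPeriodPairing` (+ three private `liftAddHom` stages), `bdRPlusToFrac` /
`periodLineFrac` (abbrevs). No named fact, no instance, no `sorry`. Brick (H1)-right + (H3) socket of the `B₂`-road memo of line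
`kato_lever` (crux K★ `stmt-BirchSwinnertonDyer-22226`); BSD / K★ / [REC] are NOT proved by any of this.

## References
* K. Kato, LNM 1553 (1993), Ch. II §1.2.4, §1.4, Thm. 1.4.1, proof of Lemma 1.4.3. [Kato1993LNM1553]
* S. Bloch, K. Kato (1990), Def. 3.10, Ex. 3.10.1, Example 3.11. [BlochKato1990]
* J.-M. Fontaine, Astérisque 223 (1994), Exp. II §1.5, Exp. III §1.5. [FontaineAsterisque223III]
* J. H. Silverman, *AEC* (2009), III §7, Prop. III.8.1; J.-P. Serre (1968), Ch. I §1.1. [SilvermanAEC2009] [Serre1968]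
-/

noncomputable section

open Field Function ValuativeRel WittVector
open scoped TensorProduct

namespace Literature.NumberTheory.PAdicHodge

open Literature.NumberTheory.GaloisRepresentations
open Literature.NumberTheory.GaloisRepresentations.IsNonarchimedeanLocalField
open Literature.NumberTheory.GaloisRepresentations.DiscreteGaloisModule
open Literature.NumberTheory.GaloisCohomology
open Literature.NumberTheory.EllipticCurves
open _root_.WeierstrassCurve

universe w

variable {F : Type} [Field F] {p : ℕ} [Fact p.Prime] {K₀ : Type} [Field K₀] (W : WeierstrassCurve K₀)

/-! ## §1 Scalars on the Tate module; the ambient `B ⊗ V_pW` -/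

/-- `pr_k(a • T) = (a mod pᵏ) • pr_k T` on the geometric torsion (`TateModule.proj_smul`). [cite: Serre1968, Ch. I §1.1] -/
theorem tateProjHom_padicInt_smul (k : ℕ) (a : ℤ_[p]) (T : W.tateModule p) :
    tateProjHom W p k (a • T) = (PadicInt.toZModPow k a).val • tateProjHom W p k T :=
  Subtype.ext (by rw [coe_tateProjHom, TateModule.proj_smul, AddSubmonoidClass.coe_nsmul, coe_tateProjHom])

section Ambient

variable [Algebra ℚ_[p] F] (𝔅 : PeriodRingData.{0, 0, 0, w} (absoluteGaloisGroup F) ℚ_[p] F)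

/-- **`T_pW → B ⊗_{ℚ_p} V_pW`, `S ↦ 1 ⊗ (1 ⊗ S)`** — the ambient of Kato's formal argument (`B ⊗ V` with the diagonal action
`PeriodRingData.tensorRep`). [cite: Kato1993LNM1553, Ch. II §1.2.4 and proof of Lemma 1.4.3] -/
def toAmbient : W.tateModule p →+ 𝔅.B ⊗[ℚ_[p]] W.rationalTateModule p :=
  (TensorProduct.mk ℚ_[p] 𝔅.B (W.rationalTateModule p) 1).toAddMonoidHom.comp (TateModule.toRational p).toAddMonoidHom

/-- Unfolding `toAmbient`. [cite: Kato1993LNM1553, Ch. II §1.2.4] -/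
@[simp] theorem toAmbient_apply (S : W.tateModule p) :
    toAmbient W 𝔅 S = (1 : 𝔅.B) ⊗ₜ[ℚ_[p]] TateModule.toRational p S := rfl

/-- ★ **`T_pW → B ⊗ V_pW` is equivariant**: `1 ⊗ 1 ⊗ σS = σ • (1 ⊗ 1 ⊗ S)` (the hypothesis `hιY`). [cite: Kato1993LNM1553, Ch. II §1.2.4] -/
theorem toAmbient_smul [Algebra K₀ F] [W.IsElliptic] (σ : absoluteGaloisGroup F) (S : W.tateModule p) :
    toAmbient W 𝔅 (restrictedTateRep W F p σ S) = 𝔅.tensorRep (restrictedRationalTateRep W F p) σ (toAmbient W 𝔅 S) := by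
  rw [toAmbient_apply, toAmbient_apply, PeriodRingData.tensorRep_apply_tmul, smul_one, restrictedTateRep_apply_apply,
    restrictedRationalTateRep_toRational]

/-- `σ` fixes the `ℚ_p`-scalars of `B`. [folklore] -/
private theorem smul_algebraMap_padic (σ : absoluteGaloisGroup F) (c : ℚ_[p]) :
    σ • algebraMap ℚ_[p] 𝔅.B c = algebraMap ℚ_[p] 𝔅.B c := by
  rw [Algebra.algebraMap_eq_smul_one, smul_comm, smul_one]

end Ambient

variable [ValuativeRel F] [TopologicalSpace F] [IsNonarchimedeanLocalField F] [CharZero F] [Fact (¬ IsUnit (p : integerC F))]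
  [IsAdicComplete (Ideal.span {(p : integerC F)}) (integerC F)] [Algebra ℚ_[p] F]
  (𝔅 : PeriodRingData.{0, 0, 0, w} (absoluteGaloisGroup F) ℚ_[p] F) (j : BDeRhamPlus (integerC F) p →+* 𝔅.B)

/-! ## §2 The period line with values in a period-ring datum receiving `B_dR⁺` -/

section LineB

/-- **`ι_B : ℤ_p(1)(F̄) →+ B`, `ζ ↦ j(ι ζ) = log_ε(ζ) · j(t)`** — the period line followed by `j : B_dR⁺(F) → B` (for `B = B_dR(F)`:
the inclusion `B_dR⁺ ⊆ B_dR`). [cite: FontaineAsterisque223III, Exp. II §1.5.4] [cite: Kato1993LNM1553, Ch. II 1.4.2] -/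
def periodLineB : (muPadicSystem F p).limit →+ 𝔅.B :=
  j.toAddMonoidHom.comp ((BdRPlusTop.of F p).symm.toAddMonoidHom.comp (BdRPlusTop.periodLine F p))

variable {𝔅 j}

/-- `ι_B(ζ^a) = a · ι_B(ζ)` when `j ∘ qpToBdR` is the `ℚ_p`-structure map of `B`. [cite: Kato1993LNM1553, Ch. II 1.4.2] -/
theorem periodLineB_twistHom (hjq : ∀ c : ℚ_[p], j (qpToBdR c) = algebraMap ℚ_[p] 𝔅.B c)
    (ζ : (muPadicSystem F p).limit) (a : ℤ_[p]) :
    periodLineB 𝔅 j (twistHom F p ζ a) = algebraMap ℚ_[p] 𝔅.B (a : ℚ_[p]) * periodLineB 𝔅 j ζ := by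
  change j ((BdRPlusTop.of F p).symm (BdRPlusTop.periodLine F p (twistHom F p ζ a))) =
    _ * j ((BdRPlusTop.of F p).symm (BdRPlusTop.periodLine F p ζ))
  rw [BdRPlusTop.periodLine_twistHom, map_mul, RingEquiv.symm_apply_apply, map_mul, hjq]

/-- ★ **Equivariance `σ • ι_B(ζ) = ι_B(σ ζ)`** when `j` intertwines `galBdRPlus σ` and the action on `B`.
[cite: FontaineAsterisque223III, Exp. II §1.5.5] -/
theorem smul_periodLineB (hj : ∀ (σ : absoluteGaloisGroup F) (b : BDeRhamPlus (integerC F) p), j (galBdRPlus σ b) = σ • j b)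
    (σ : absoluteGaloisGroup F) (ζ : (muPadicSystem F p).limit) :
    σ • periodLineB 𝔅 j ζ = periodLineB 𝔅 j (tateModuleMuPadic F p σ ζ) := by
  change σ • j ((BdRPlusTop.of F p).symm (BdRPlusTop.periodLine F p ζ)) =
    j ((BdRPlusTop.of F p).symm (BdRPlusTop.periodLine F p (tateModuleMuPadic F p σ ζ)))
  rw [← BdRPlusTop.gal_periodLine, ← hj]
  rfl

/-- `ι_B` is injective when `j` is (and `θ` is onto). [cite: FontaineAsterisque223III, Exp. II §1.5.4] -/
theorem periodLineB_injective (hF : Function.Surjective (fontaineTheta (integerC F) p)) (hjinj : Injective j) :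
    Injective (periodLineB 𝔅 j) :=
  hjinj.comp ((BdRPlusTop.of F p).symm.injective.comp (BdRPlusTop.periodLine_injective hF))

end LineB

/-! ## §3 `e_∞` is `ℤ_p`-bilinear in twist form; the extended pairing `⟨S, b ⊗ (c ⊗ T)⟩~ = b · c · ι_B(e_∞(S, T))` -/

section Weil

variable [Algebra K₀ F]
  (e : (k : ℕ) → geomTorsion W ((p ^ k : ℕ) : ℤ) → geomTorsion W ((p ^ k : ℕ) : ℤ) → AlgebraicClosure K₀)
  (hμ : ∀ k S T, e k S T ^ (p ^ k) = 1) (hadd₁ : ∀ k S₁ S₂ T, e k (S₁ + S₂) T = e k S₁ T * e k S₂ T)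
  (hadd₂ : ∀ k S T₁ T₂, e k S (T₁ + T₂) = e k S T₁ * e k S T₂)
  (hgal : ∀ k (σ : absoluteGaloisGroup K₀) (S T : geomTorsion W ((p ^ k : ℕ) : ℤ)), σ • e k S T = e k (σ • S) (σ • T))
  (hcompat : ∀ k (S T : geomTorsion W ((p ^ (k + 1) : ℕ) : ℤ)),
    e k (torsionMulHom W (p ^ (k + 1)) (p ^ k) p (pow_succ p k).symm S)
      (torsionMulHom W (p ^ (k + 1)) (p ^ k) p (pow_succ p k).symm T) = e (k + 1) S T ^ p)
  (hjq : ∀ c : ℚ_[p], j (qpToBdR c) = algebraMap ℚ_[p] 𝔅.B c)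

omit [ValuativeRel F] [TopologicalSpace F] [IsNonarchimedeanLocalField F] [CharZero F] [Fact (¬ IsUnit (p : integerC F))]
  [IsAdicComplete (Ideal.span {(p : integerC F)}) (integerC F)] [Algebra ℚ_[p] F] in
/-- ★ **`e_∞(S, a • T) = e_∞(S, T)^a`** for `a ∈ ℤ_p` (levelwise `e_k(S_k, (a mod pᵏ) T_k) = e_k(S_k, T_k)^{a mod pᵏ}` and the
coordinate of `ζ^a` is `(a mod pᵏ) ζ_k`). [cite: SilvermanAEC2009, Prop. III.8.1 (a)] [cite: Kato1993LNM1553, Ch. II 1.4.2] -/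
theorem weilPairingPadicHom_smul_right (S T : W.tateModule p) (a : ℤ_[p]) :
    weilPairingPadicHom W F p e hμ hadd₁ hadd₂ hcompat S (a • T) =
      twistHom F p (weilPairingPadicHom W F p e hμ hadd₁ hadd₂ hcompat S T) a := by
  refine Subtype.ext (funext fun k => ?_)
  rw [coe_weilPairingPadicHom, coe_twistHom, twistCoord_eq_zsmul, coe_weilPairingPadicHom, weilPairingPadicCoord,
    weilPairingPadicCoord, tateProjHom_padicInt_smul, map_nsmul, map_nsmul, natCast_zsmul]

/-- Stage 1 (for fixed `S`): `(c, T) ↦ c · ι_B(e_∞(S, T))`, biadditive. [cite: Kato1993LNM1553, Ch. II, proof of Lemma 1.4.3] -/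
private def stage₁ (S : W.tateModule p) : ℚ_[p] →+ W.tateModule p →+ 𝔅.B :=
  ((AddMonoidHom.mul : 𝔅.B →+ 𝔅.B →+ 𝔅.B).comp (algebraMap ℚ_[p] 𝔅.B).toAddMonoidHom).compl₂
    ((periodLineB 𝔅 j).comp (weilPairingPadicHom W F p e hμ hadd₁ hadd₂ hcompat S))

include hjq in
/-- Stage 1 is `ℤ_p`-balanced: `(a • c) · ι_B(e_∞(S,T)) = c · ι_B(e_∞(S, a • T))`. [cite: Kato1993LNM1553, Ch. II, proof of Lemma 1.4.3] -/
private theorem stage₁_balanced (S : W.tateModule p) (a : ℤ_[p]) (c : ℚ_[p]) (T : W.tateModule p) :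
    stage₁ W 𝔅 j e hμ hadd₁ hadd₂ hcompat S (a • c) T = stage₁ W 𝔅 j e hμ hadd₁ hadd₂ hcompat S c (a • T) := by
  change algebraMap ℚ_[p] 𝔅.B (a • c) * periodLineB 𝔅 j (weilPairingPadicHom W F p e hμ hadd₁ hadd₂ hcompat S T) =
    algebraMap ℚ_[p] 𝔅.B c * periodLineB 𝔅 j (weilPairingPadicHom W F p e hμ hadd₁ hadd₂ hcompat S (a • T))
  rw [weilPairingPadicHom_smul_right, periodLineB_twistHom hjq, Algebra.smul_def, PadicInt.algebraMap_apply, map_mul]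
  ring

/-- Extensionality for additive maps out of the synonym `V_pW = ℚ_p ⊗_{ℤ_p} T_pW`: agreement on pure tensors suffices. [folklore] -/
private theorem addMonoidHom_rational_ext {X : Type*} [AddCommGroup X] {f g : W.rationalTateModule p →+ X}
    (h : ∀ (c : ℚ_[p]) (T : W.tateModule p), f (c ⊗ₜ[ℤ_[p]] T) = g (c ⊗ₜ[ℤ_[p]] T)) : f = g :=
  AddMonoidHom.ext fun v => TensorProduct.induction_on (motive := fun v => f v = g v) v
    ((map_zero f).trans (map_zero g).symm) (fun c T => h c T)
    (fun x y hx hy => (map_add f x y).trans (((congrArg₂ (· + ·) hx hy)).trans (map_add g x y).symm))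

/-- Stage 2 (for fixed `S`): `V_pW = ℚ_p ⊗_{ℤ_p} T_pW →+ B`, `c ⊗ T ↦ c · ι_B(e_∞(S, T))`. [cite: Kato1993LNM1553, Ch. II, proof of Lemma 1.4.3] -/
private def stage₂ (S : W.tateModule p) : W.rationalTateModule p →+ 𝔅.B :=
  TensorProduct.liftAddHom (stage₁ W 𝔅 j e hμ hadd₁ hadd₂ hcompat S) (stage₁_balanced W 𝔅 j e hμ hadd₁ hadd₂ hcompat hjq S)

/-- Stage 2 on pure tensors. [cite: Kato1993LNM1553, Ch. II, proof of Lemma 1.4.3] -/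
private theorem stage₂_tmul (S : W.tateModule p) (c : ℚ_[p]) (T : W.tateModule p) :
    stage₂ W 𝔅 j e hμ hadd₁ hadd₂ hcompat hjq S (c ⊗ₜ[ℤ_[p]] T) =
      algebraMap ℚ_[p] 𝔅.B c * periodLineB 𝔅 j (weilPairingPadicHom W F p e hμ hadd₁ hadd₂ hcompat S T) :=
  TensorProduct.liftAddHom_tmul _ _ c T

/-- Stage 2 is `ℚ_p`-linear. [cite: Kato1993LNM1553, Ch. II, proof of Lemma 1.4.3] -/
private theorem stage₂_smul (S : W.tateModule p) (c : ℚ_[p]) (v : W.rationalTateModule p) :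
    stage₂ W 𝔅 j e hμ hadd₁ hadd₂ hcompat hjq S (c • v) =
      algebraMap ℚ_[p] 𝔅.B c * stage₂ W 𝔅 j e hμ hadd₁ hadd₂ hcompat hjq S v := by
  have h := addMonoidHom_rational_ext W
    (f := (stage₂ W 𝔅 j e hμ hadd₁ hadd₂ hcompat hjq S).comp (DistribSMul.toAddMonoidHom (W.rationalTateModule p) c))
    (g := (AddMonoidHom.mulLeft (algebraMap ℚ_[p] 𝔅.B c)).comp (stage₂ W 𝔅 j e hμ hadd₁ hadd₂ hcompat hjq S))
    fun c' T => by
      change stage₂ W 𝔅 j e hμ hadd₁ hadd₂ hcompat hjq S (c • (c' ⊗ₜ[ℤ_[p]] T)) =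
        algebraMap ℚ_[p] 𝔅.B c * stage₂ W 𝔅 j e hμ hadd₁ hadd₂ hcompat hjq S (c' ⊗ₜ[ℤ_[p]] T)
      rw [TensorProduct.smul_tmul', stage₂_tmul, stage₂_tmul, smul_eq_mul, map_mul, mul_assoc]
  exact DFunLike.congr_fun h v

/-- Stage 2 is additive in `S`. [cite: Kato1993LNM1553, Ch. II, proof of Lemma 1.4.3] -/
private theorem stage₂_add (S S' : W.tateModule p) :
    stage₂ W 𝔅 j e hμ hadd₁ hadd₂ hcompat hjq (S + S') =
      stage₂ W 𝔅 j e hμ hadd₁ hadd₂ hcompat hjq S + stage₂ W 𝔅 j e hμ hadd₁ hadd₂ hcompat hjq S' :=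
  addMonoidHom_rational_ext W fun c T => by
    rw [AddMonoidHom.add_apply, stage₂_tmul, stage₂_tmul, stage₂_tmul, map_add, AddMonoidHom.add_apply, map_add, mul_add]

/-- Stage 3 (for fixed `S`): `B ⊗_{ℚ_p} V_pW →+ B`, `b ⊗ v ↦ b · stage₂(v)` (`ℚ_p`-balanced by `stage₂_smul`).
[cite: Kato1993LNM1553, Ch. II, proof of Lemma 1.4.3] -/
private def stage₃ (S : W.tateModule p) : 𝔅.B ⊗[ℚ_[p]] W.rationalTateModule p →+ 𝔅.B :=
  TensorProduct.liftAddHom ((AddMonoidHom.mul : 𝔅.B →+ 𝔅.B →+ 𝔅.B).compl₂ (stage₂ W 𝔅 j e hμ hadd₁ hadd₂ hcompat hjq S))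
    fun c b v => by
      change (c • b) * stage₂ W 𝔅 j e hμ hadd₁ hadd₂ hcompat hjq S v = b * stage₂ W 𝔅 j e hμ hadd₁ hadd₂ hcompat hjq S (c • v)
      rw [stage₂_smul, Algebra.smul_def]
      ring

/-- Stage 3 on pure tensors. [cite: Kato1993LNM1553, Ch. II, proof of Lemma 1.4.3] -/
private theorem stage₃_tmul (S : W.tateModule p) (b : 𝔅.B) (v : W.rationalTateModule p) :
    stage₃ W 𝔅 j e hμ hadd₁ hadd₂ hcompat hjq S (b ⊗ₜ[ℚ_[p]] v) = b * stage₂ W 𝔅 j e hμ hadd₁ hadd₂ hcompat hjq S v :=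
  TensorProduct.liftAddHom_tmul _ _ b v

/-- ★ **The extended pairing `⟨·,·⟩~ : T_pW × (B ⊗_{ℚ_p} V_pW) → B`, `⟨S, b ⊗ (c ⊗ T)⟩~ = b · c · ι_B(e_∞(S, T))`** — Kato's
`e_B : (B ⊗ V) × (B ⊗ V) → B(1)` restricted to `T × (B ⊗ V)` and read through the period line `ℤ_p(1) → ℤ_p · t`.
[cite: Kato1993LNM1553, Ch. II §1.2.4 and proof of Lemma 1.4.3] -/
def weilPeriodPairing : W.tateModule p →+ (𝔅.B ⊗[ℚ_[p]] W.rationalTateModule p) →+ 𝔅.B :=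
  AddMonoidHom.mk' (fun S => stage₃ W 𝔅 j e hμ hadd₁ hadd₂ hcompat hjq S) fun S S' => by
    refine AddMonoidHom.ext fun y => ?_
    induction y using TensorProduct.induction_on with
    | zero => simp only [map_zero]
    | tmul b v => rw [AddMonoidHom.add_apply, stage₃_tmul, stage₃_tmul, stage₃_tmul, stage₂_add, AddMonoidHom.add_apply, mul_add]
    | add x y hx hy => rw [map_add, hx, hy, map_add]

/-- ★ **Values on pure tensors: `⟨S, b ⊗ (c ⊗ T)⟩~ = b · (c · ι_B(e_∞(S, T)))`.** [cite: Kato1993LNM1553, Ch. II, proof of Lemma 1.4.3] -/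
theorem weilPeriodPairing_tmul (S : W.tateModule p) (b : 𝔅.B) (c : ℚ_[p]) (T : W.tateModule p) :
    weilPeriodPairing W 𝔅 j e hμ hadd₁ hadd₂ hcompat hjq S (b ⊗ₜ[ℚ_[p]] (c ⊗ₜ[ℤ_[p]] T : W.rationalTateModule p)) =
      b * (algebraMap ℚ_[p] 𝔅.B c * periodLineB 𝔅 j (weilPairingPadicHom W F p e hμ hadd₁ hadd₂ hcompat S T)) :=
  (stage₃_tmul W 𝔅 j e hμ hadd₁ hadd₂ hcompat hjq S b _).trans (by rw [stage₂_tmul])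

/-- `⟨S, b ⊗ v⟩~ = b · ⟨S, 1 ⊗ v⟩~`. [cite: Kato1993LNM1553, Ch. II, proof of Lemma 1.4.3] -/
theorem weilPeriodPairing_tmul_eq_mul (S : W.tateModule p) (b : 𝔅.B) (v : W.rationalTateModule p) :
    weilPeriodPairing W 𝔅 j e hμ hadd₁ hadd₂ hcompat hjq S (b ⊗ₜ[ℚ_[p]] v) =
      b * weilPeriodPairing W 𝔅 j e hμ hadd₁ hadd₂ hcompat hjq S ((1 : 𝔅.B) ⊗ₜ[ℚ_[p]] v) := by
  change stage₃ W 𝔅 j e hμ hadd₁ hadd₂ hcompat hjq S (b ⊗ₜ[ℚ_[p]] v) =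
    b * stage₃ W 𝔅 j e hμ hadd₁ hadd₂ hcompat hjq S ((1 : 𝔅.B) ⊗ₜ[ℚ_[p]] v)
  rw [stage₃_tmul, stage₃_tmul, one_mul]

/-- ★ **Compatibility with the Weil pairing along `T_pW → B ⊗ V_pW`**: `⟨S, 1 ⊗ 1 ⊗ T⟩~ = ι_B(e_∞(S, T))` (the hypothesis
`hcompat` of `isCoboundaryLift_cupCocycle_right`). [cite: Kato1993LNM1553, Ch. II, proof of Lemma 1.4.3] -/
theorem weilPeriodPairing_toAmbient (S T : W.tateModule p) :
    weilPeriodPairing W 𝔅 j e hμ hadd₁ hadd₂ hcompat hjq S (toAmbient W 𝔅 T) =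
      periodLineB 𝔅 j ((weilContPairingPadic W F p e hμ hadd₁ hadd₂ hgal hcompat).toLin S T) := by
  rw [toAmbient_apply, TateModule.toRational_apply, weilPeriodPairing_tmul, map_one, one_mul, one_mul,
    weilContPairingPadic_toLin_apply]

variable (hj : ∀ (σ : absoluteGaloisGroup F) (b : BDeRhamPlus (integerC F) p), j (galBdRPlus σ b) = σ • j b) [W.IsElliptic]

include hj hgal in
/-- ★ **Equivariance of the extended pairing: `σ • ⟨S, y⟩~ = ⟨σ S, σ y⟩~`**, `σ y` the diagonal action `tensorRep` on `B ⊗ V_pW`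
(the hypothesis `hequiv` of `isCoboundaryLift_cupCocycle_right`; from `σ • ι_B ζ = ι_B(σ ζ)` and `e_∞(σS, σT) = σ e_∞(S, T)`).
[cite: Kato1993LNM1553, Ch. II, proof of Lemma 1.4.3] [cite: FontaineAsterisque223III, Exp. II §1.5.5] -/
theorem smul_weilPeriodPairing (σ : absoluteGaloisGroup F) (S : W.tateModule p) (y : 𝔅.B ⊗[ℚ_[p]] W.rationalTateModule p) :
    σ • weilPeriodPairing W 𝔅 j e hμ hadd₁ hadd₂ hcompat hjq S y =
      weilPeriodPairing W 𝔅 j e hμ hadd₁ hadd₂ hcompat hjq (restrictedTateRep W F p σ S)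
        (𝔅.tensorRep (restrictedRationalTateRep W F p) σ y) := by
  -- the case `y = 1 ⊗ v`, as an identity of additive maps in `v` (pure tensors suffice)
  have h1 := addMonoidHom_rational_ext W
    (f := (DistribSMul.toAddMonoidHom 𝔅.B σ).comp
      ((weilPeriodPairing W 𝔅 j e hμ hadd₁ hadd₂ hcompat hjq S).comp
        (TensorProduct.mk ℚ_[p] 𝔅.B (W.rationalTateModule p) 1).toAddMonoidHom))
    (g := ((weilPeriodPairing W 𝔅 j e hμ hadd₁ hadd₂ hcompat hjq (restrictedTateRep W F p σ S)).comp
        (TensorProduct.mk ℚ_[p] 𝔅.B (W.rationalTateModule p) 1).toAddMonoidHom).comp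
      (restrictedRationalTateRep W F p σ).toAddMonoidHom)
    fun c T => by
      change σ • weilPeriodPairing W 𝔅 j e hμ hadd₁ hadd₂ hcompat hjq S ((1 : 𝔅.B) ⊗ₜ[ℚ_[p]] (c ⊗ₜ[ℤ_[p]] T)) =
        weilPeriodPairing W 𝔅 j e hμ hadd₁ hadd₂ hcompat hjq (restrictedTateRep W F p σ S)
          ((1 : 𝔅.B) ⊗ₜ[ℚ_[p]] restrictedRationalTateRep W F p σ (c ⊗ₜ[ℤ_[p]] T))
      have hV : restrictedRationalTateRep W F p σ (c ⊗ₜ[ℤ_[p]] T : W.rationalTateModule p) =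
          (c ⊗ₜ[ℤ_[p]] (restrictedTateRep W F p σ T) : W.rationalTateModule p) := by
        rw [restrictedTateRep_apply_apply]; rfl
      rw [hV, weilPeriodPairing_tmul, weilPeriodPairing_tmul, one_mul, one_mul, smul_mul', smul_algebraMap_padic,
        smul_periodLineB hj]
      congr 1
      exact congrArg (periodLineB 𝔅 j) ((weilContPairingPadic W F p e hμ hadd₁ hadd₂ hgal hcompat).toLin_smul σ S T).symm
  induction y using TensorProduct.induction_on with
  | zero => simp only [map_zero, smul_zero]
  | tmul b v =>
    rw [PeriodRingData.tensorRep_apply_tmul, weilPeriodPairing_tmul_eq_mul, smul_mul',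
      weilPeriodPairing_tmul_eq_mul W 𝔅 j e hμ hadd₁ hadd₂ hcompat hjq _ (σ • b)]
    exact congrArg ((σ • b) * ·) (DFunLike.congr_fun h1 v)
  | add x x' hx hx' => rw [map_add, smul_add, hx, hx', map_add, map_add]

/-! ## §4 Kato's formal argument for `⟨η, κ⟩`: `σ ↦ −⟨η σ, σ ỹ⟩~` presents `η ∪ κ` when `κ = ∂ỹ` in `B ⊗ V_pW` -/

include hj hgal in
/-- ★★ **Kato II Lemma 1.4.3, formal part, for the Tate pairing.** If the cocycle `κ : Γ_F → T_pW` bounds in `B ⊗_{ℚ_p} V_pW`,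
`1 ⊗ 1 ⊗ κ(τ) = τ ỹ − ỹ` (for a Kummer cocycle `κ_P`: brick K1, `ỹ = y_P ∈ B_dR⁺ ⊗ V`), then for every cocycle `η` the cochain
**`g(σ) := −⟨η σ, σ ỹ⟩~`** presents `η ∪_{e_∞} κ` through `ι_B`: `ι_B((η ∪ κ)(σ, τ)) = σ g(τ) − g(στ) + g(σ)`.
[cite: Kato1993LNM1553, Ch. II, proof of Lemma 1.4.3] [cite: BlochKato1990, Ex. 3.10.1 and Example 3.11] -/
theorem isCoboundaryLift_weilContPairingPadic_right (η κ : contOneCocycles (restrictedTateRep W F p).toTopRep)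
    (y₀ : 𝔅.B ⊗[ℚ_[p]] W.rationalTateModule p)
    (hy₀ : ∀ τ, toAmbient W 𝔅 (κ.1 τ) = 𝔅.tensorRep (restrictedRationalTateRep W F p) τ y₀ - y₀) :
    IsCoboundaryLift (ρ := tateModuleMuPadic F p) (DistribMulAction.toModuleEnd F 𝔅.B) (periodLineB 𝔅 j)
      (fun σ => -weilPeriodPairing W 𝔅 j e hμ hadd₁ hadd₂ hcompat hjq (η.1 σ)
        (𝔅.tensorRep (restrictedRationalTateRep W F p) σ y₀))
      ((weilContPairingPadic W F p e hμ hadd₁ hadd₂ hgal hcompat).cupCocycle η κ) :=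
  (weilContPairingPadic W F p e hμ hadd₁ hadd₂ hgal hcompat).isCoboundaryLift_cupCocycle_right
    (π := DistribMulAction.toModuleEnd F 𝔅.B) (ι := periodLineB 𝔅 j)
    (πY := 𝔅.tensorRep (restrictedRationalTateRep W F p)) (ιY := toAmbient W 𝔅)
    (Pt := weilPeriodPairing W 𝔅 j e hμ hadd₁ hadd₂ hcompat hjq)
    (fun σ S y => smul_weilPeriodPairing W 𝔅 j e hμ hadd₁ hadd₂ hgal hcompat hjq hj σ S y)
    (fun S T => weilPeriodPairing_toAmbient W 𝔅 j e hμ hadd₁ hadd₂ hgal hcompat hjq S T)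
    (fun σ T => toAmbient_smul W 𝔅 σ T) η κ y₀ hy₀

include hj hgal in
/-- The same from the tree's `IsFilZeroCoboundary` (brick K1's conclusion): if `σ ↦ 1 ⊗ κ(σ)` is a `Fil⁰`-coboundary of `B ⊗ V_pW`
then SOME `ỹ ∈ Fil⁰B ⊗ V_pW` gives the presentation `g(σ) = −⟨η σ, σ ỹ⟩~` of `η ∪ κ`.
[cite: Kato1993LNM1553, Ch. II §1.2.4 and proof of Lemma 1.4.3] [cite: BlochKato1990, Example 3.11] -/
theorem isCoboundaryLift_weilContPairingPadic_right_of_isFilZeroCoboundary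
    (η κ : contOneCocycles (restrictedTateRep W F p).toTopRep)
    (hκ : 𝔅.IsFilZeroCoboundary (restrictedRationalTateRep W F p) fun τ => (1 : 𝔅.B) ⊗ₜ[ℚ_[p]] TateModule.toRational p (κ.1 τ)) :
    ∃ y₀ ∈ 𝔅.filTensor (W.rationalTateModule p) 0,
      IsCoboundaryLift (ρ := tateModuleMuPadic F p) (DistribMulAction.toModuleEnd F 𝔅.B) (periodLineB 𝔅 j)
        (fun σ => -weilPeriodPairing W 𝔅 j e hμ hadd₁ hadd₂ hcompat hjq (η.1 σ)
          (𝔅.tensorRep (restrictedRationalTateRep W F p) σ y₀))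
        ((weilContPairingPadic W F p e hμ hadd₁ hadd₂ hgal hcompat).cupCocycle η κ) := by
  obtain ⟨y₀, hy₀, h⟩ := hκ
  exact ⟨y₀, hy₀, isCoboundaryLift_weilContPairingPadic_right W 𝔅 j e hμ hadd₁ hadd₂ hgal hcompat hjq hj η κ y₀ h⟩

variable [LocallyCompactSpace (absoluteGaloisGroup F)] [CharZero K₀]

include hj hgal in
/-- ★★ **`⟨[η], [κ]⟩ = inv_∞[c]` for ANY continuous `2`-cocycle `c` of `ℤ_p(1)` presented by `g(σ) = −⟨η σ, σ ỹ⟩~`** (`ι_B`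
injective): the tree's `ℤ_p`-valued local Tate pairing with a class bounding in `B ⊗ V_pW` is the invariant of the connecting class of
the explicit `B`-valued cochain `g` (`tatePairing_oneCocycleClass_eq_invPadic_twoCocycleClass` + `IsCoboundaryLift.unique`).
[cite: Kato1993LNM1553, Ch. II §1.4, Thm. 1.4.1 (3) and proof of Lemma 1.4.3] -/
theorem tatePairing_eq_invPadic_twoCocycleClass_of_isCoboundaryLift (hF : Function.Surjective (fontaineTheta (integerC F) p))
    (hjinj : Injective j) (η κ : contOneCocycles (restrictedTateRep W F p).toTopRep)
    (y₀ : 𝔅.B ⊗[ℚ_[p]] W.rationalTateModule p)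
    (hy₀ : ∀ τ, toAmbient W 𝔅 (κ.1 τ) = 𝔅.tensorRep (restrictedRationalTateRep W F p) τ y₀ - y₀)
    {c : contTwoCocycles (tateModuleMuPadic F p).toTopRep}
    (hc : IsCoboundaryLift (ρ := tateModuleMuPadic F p) (DistribMulAction.toModuleEnd F 𝔅.B) (periodLineB 𝔅 j)
      (fun σ => -weilPeriodPairing W 𝔅 j e hμ hadd₁ hadd₂ hcompat hjq (η.1 σ)
        (𝔅.tensorRep (restrictedRationalTateRep W F p) σ y₀)) c) :
    tatePairing W F p e hμ hadd₁ hadd₂ hgal hcompat (oneCocycleClass _ η) (oneCocycleClass _ κ) =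
      invPadic F p (twoCocycleClass _ c) := by
  rw [tatePairing_oneCocycleClass_eq_invPadic_twoCocycleClass,
    (isCoboundaryLift_weilContPairingPadic_right W 𝔅 j e hμ hadd₁ hadd₂ hgal hcompat hjq hj η κ y₀ hy₀).unique
      (periodLineB_injective hF hjinj) hc]

end Weil

/-! ## §5 The instance `B = B_dR(F)`, `j = B_dR⁺ ⊆ B_dR` -/

section BdR

variable (hp : valuation F p < 1)

/-- **`j = B_dR⁺(F) ⊆ B_dR(F)`** with values typed in the datum `bdRPeriodRingData hp`. [cite: FontaineAsterisque223III, Exp. II §1.5.5] -/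
abbrev bdRPlusToFrac : BDeRhamPlus (integerC F) p →+* (bdRPeriodRingData (F := F) (p := p) hp).B :=
  algebraMap (BDeRhamPlus (integerC F) p) (FracBdR F p)

/-- **`B_dR⁺ ⊆ B_dR` intertwines the Galois actions** (`smul_algebraMap_fracBdR`). [cite: FontaineAsterisque223III, Exp. II §1.5.5] -/
theorem bdRPlusToFrac_galBdRPlus (σ : absoluteGaloisGroup F) (b : BDeRhamPlus (integerC F) p) :
    bdRPlusToFrac hp (galBdRPlus σ b) = σ • bdRPlusToFrac hp b :=
  (smul_algebraMap_fracBdR σ b).symm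

/-- Under the canonical `ℚ_p`-structure of `F`, `j ∘ qpToBdR` is the `ℚ_p`-structure map of the datum. [cite: FontaineAsterisque223III, Exp. II §1.5] -/
theorem bdRPlusToFrac_qpToBdR (halg : ∀ c : ℚ_[p], algebraMap ℚ_[p] F c = LocalField.padicRingHom F p hp c) (c : ℚ_[p]) :
    bdRPlusToFrac hp (qpToBdR c) = algebraMap ℚ_[p] (bdRPeriodRingData (F := F) (p := p) hp).B c := by
  rw [PeriodRingData.algebraMap_eq, algebraMap_bdRPeriodRingData (surjective_fontaineTheta_integerC hp) hp,
    embBdRHom_algebraMap_padic hp (surjective_fontaineTheta_integerC hp) halg]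
  rfl

/-- `B_dR⁺ ⊆ B_dR` is injective (`B_dR⁺` is a domain). [cite: FontaineAsterisque223III, Exp. II §1.5.5] -/
theorem bdRPlusToFrac_injective : Injective (bdRPlusToFrac (F := F) (p := p) hp) :=
  algebraMap_fracBdR_injective (F := F) (p := p)

/-- **The period line into `B_dR(F)`**: `ι_dR`, `ε^a ↦ a · t ∈ B_dR`. [cite: FontaineAsterisque223III, Exp. II §1.5.4] -/
abbrev periodLineFrac : (muPadicSystem F p).limit →+ (bdRPeriodRingData (F := F) (p := p) hp).B :=
  periodLineB (bdRPeriodRingData hp) (bdRPlusToFrac hp)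

/-- `ι_dR` is injective. [cite: FontaineAsterisque223III, Exp. II §1.5.4] -/
theorem periodLineFrac_injective : Injective (periodLineFrac (F := F) (p := p) hp) :=
  periodLineB_injective (surjective_fontaineTheta_integerC hp) (bdRPlusToFrac_injective hp)

/-- `ι_dR` is equivariant. [cite: FontaineAsterisque223III, Exp. II §1.5.5] -/
theorem smul_periodLineFrac (σ : absoluteGaloisGroup F) (ζ : (muPadicSystem F p).limit) :
    σ • periodLineFrac (F := F) (p := p) hp ζ = periodLineFrac hp (tateModuleMuPadic F p σ ζ) :=
  smul_periodLineB (bdRPlusToFrac_galBdRPlus hp) σ ζ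

end BdR

end Literature.NumberTheory.PAdicHodge

end
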